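import Summits.HodgeConjecture.HodgeConjecture.Theses.CurveNetMordellWeil
import Summits.HodgeConjecture.HodgeConjecture.Theorems.BoundaryReadoutPullbackAlgebraic
import Literature.AlgebraicGeometry.Motives.SegreEmbedding
import HarnessLib

/-!
# Crux `VerticalSupportFourfolds` (stmt-HodgeConjecture-2784), line `andre_motivated_42` — registered stub
# `stub_diagonalPullbackAlgebraic`, CLOSED by the tree's pull-back theorem

Route `CurveNetMordellWeil` of `HodgeConjecture`. The registered skeleton
`Cruxes/VerticalSupportFourfolds/Lines/andre_motivated_42.lean` isolates as a stub the pull-back of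
algebraic classes along the DIAGONAL `Δ = (𝟙, 𝟙) : V ⟶ V ⊗ V` of a smooth projective complex variety `V`
(the leaf of André's motivated-cycle formalism where correspondences are composed and restricted to the
diagonal). It is the special case `j = Δ` of Fulton's Cor. 19.2 (b) — pull-back along ANY `ℂ`-morphism of
smooth projective varieties preserves `algebraicClasses` — which is a THEOREM of the tree since 2026-08-17
(`Theorems.fulton1998_map_mem_algebraicClasses_holds`, `Theorems/BoundaryReadoutPullbackAlgebraic.lean`,
deformation to the normal cone, crux `PullbackAlgebraic` stmt-HodgeConjecture-1071 closed), the product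
`V ⊗ V` being smooth projective of dimension `d + d` (`Motives.IsSmoothProjective.tensor_holds`, Segre). Landed
after the skeleton was registered and never credited to the stub; this file records the registered
signature. No mathematics beyond the two citations.

## References

* [Fulton1998] W. Fulton, Intersection Theory, 2nd ed. (1998), Cor. 19.2 (b).
* [VoisinHodgeII2003] C. Voisin, Hodge Theory and Complex Algebraic Geometry II (2003), Prop. 9.21 (i).
* [Hartshorne1977] R. Hartshorne, Algebraic Geometry (1977), II Ex. 5.11, III Prop. 10.1 (d).
-/

noncomputable section

-- `Summit.HodgeConjecture.HodgeConjecture.…` is the mandated namespace (single-conjunct summit).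
set_option linter.dupNamespace false

namespace Summit.HodgeConjecture.HodgeConjecture.Theorems.VerticalSupportFourfolds

open CategoryTheory AlgebraicGeometry MonoidalCategory CartesianMonoidalCategory
open Literature.AlgebraicGeometry.Motives Literature.AlgebraicGeometry.HodgeTheory

/-- **Registered stub `stub_diagonalPullbackAlgebraic` of the line `andre_motivated_42`** (crux
`VerticalSupportFourfolds`, stmt-HodgeConjecture-2784), verbatim: for a smooth projective complex variety
`V` of dimension `d` and `c ∈ algebraicClasses (V ⊗ V) p`, the pull-back `Δ^* c` along the diagonal
`Δ = lift (𝟙 V) (𝟙 V) : V ⟶ V ⊗ V` lies in `algebraicClasses V p`. Fulton Cor. 19.2 (b) for `j = Δ`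
(`Theorems.fulton1998_map_mem_algebraicClasses_holds`) with `V ⊗ V` smooth projective of dimension
`d + d` (`IsSmoothProjective.tensor_holds`). [cite: Fulton1998, Cor. 19.2 (b)]
[cite: VoisinHodgeII2003, Prop. 9.21 (i)] -/
theorem stub_diagonalPullbackAlgebraic :
    ∀ ⦃d : ℕ⦄ ⦃V : SchemeOver ℂ⦄, IsSmoothProjective d V → ∀ (p : ℕ)
      ⦃c : complexBetti (V ⊗ V) (2 * p)⦄, c ∈ algebraicClasses (V ⊗ V) p →
        complexBetti.map (lift (𝟙 V) (𝟙 V)) (2 * p) c ∈ algebraicClasses V p :=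
  fun _ V hV p c hc ↦
    fulton1998_map_mem_algebraicClasses_holds (lift (𝟙 V) (𝟙 V)) (IsSmoothProjective.tensor_holds hV hV)
      hV p c hc

end Summit.HodgeConjecture.HodgeConjecture.Theorems.VerticalSupportFourfolds

end
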